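import Summits.BirchSwinnertonDyer.BirchSwinnertonDyer.Theorems.ErratumRoadFiveIMCDivOneSidedCongruenceDefs
import Summits.BirchSwinnertonDyer.BirchSwinnertonDyer.Theorems.ErratumRoadFiveIMCDivOneSidedNoFiniteSubmoduleFree
import HarnessLib

/-!
# Route `ErratumRoadFive`, crux `IMCDivAtErratumDataAll` (item stmt-BirchSwinnertonDyer-19270): the
# one-sided congruence package WITHOUT Lemma 2.2 — shapes and the glue to the crux and to both
# registered stubs (torsion of `X^Σ_ac(E[p^∞])` is the only input on the fixed module)

Cell `bsd-stepL` (run/shared/lean/pub/bsd-stepL/), PART 1b ACCEL seat `bsd-stepL-imc24c` (prover, row (3));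
`--supports stmt-BirchSwinnertonDyer-19270 --as helper`; fourth file of the seat: the packaging of
`Theorems/ErratumRoadFiveIMCDivOneSidedNoFiniteSubmoduleFree.lean` (torsion-only transfer on `X_ac`)
in the currency of `Theorems/ErratumRoadFiveIMCDivOneSidedCongruenceDefs.lean` (the glue). HONEST
FRAMING: nothing is asserted about any curve; the item is NOT closed; BSD is proved for no pair; two
`Prop`-valued SHAPES (claim-tagged, assert nothing) and theorems; no named fact; no `sorry`.

## What this file proves

* §1 shape **`P2.OneSidedCongruenceDataTorsionAt W p κ 𝔭 γ ι f`** = `P2.OneSidedCongruenceDataAt` with the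
  conjunct "no nonzero finite-length submodule of `X^Σ`" (erratum Lemma 2.2) DELETED (so it is implied by
  that package, conjunct by conjunct); it still gives the `R₀`-frame with
  `Ch_Λ(X_ac^∅)·R₀⟦T⟧ ⊆ (L)` (`P2.exists_unrFrame_charIdeal_map_le_of_oneSidedCongruenceDataTorsionAt`,
  by `AcSelmer.XAc.charIdeal_map_toUnr_le_span_of_oneSided_congruences_of_isTorsion`) and the crux's
  ♭-frame conjunct (`P2.exists_intCoreFrame_of_oneSidedCongruenceDataTorsionAt`).
* §2 shape **`P2.OneSidedCongruenceDataTorsionAtErratumData W p`** (crux binders VERBATIM) and the glue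
  **`P2.imcDivIntCoreFrameAtErratumData_of_oneSidedCongruenceDataTorsion`** :
  `… → P2.IMCDivIntCoreFrameAtErratumData W p`, with both REGISTERED stub signatures of crux 19270 as
  corollaries (`P2.stub_imcDivErratum_{nonsplitAtP,splitAtP}_of_oneSidedCongruenceDataTorsion`) — ONE
  sign-blind proof.

NET: on the one-sided road the typed package per erratum datum is {frame [Cas18 Thm. 3.1 ∕ A206 ∕
Thm. C♯], `Σ` finite, `X^Σ` torsion [CTL], members with (b)+Lemma 2.1 [objects D1∕D2], (2.5)_m [FW21
Thm. 4.41 — the ONE PREPRINT brick], (c) [Cas20 Thm. 2.11], one-sided `Σ`-removal datum [GV00 2.4 ∕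
Cas18 (3.1)]} — Lemma 2.2 no longer appears.

References: [Castella2018Erratum] (a)–(c), Lemma 2.1, (2.5), proof of Thm. 1.1 (pp. 2–4);
[Skinner2016PacificMC] §3.1; [Castella2018] Def. 2.2, (3.1), Thm. 3.1; [FouquetWan2021] Thm. 4.41 (PREPRINT).
-/

set_option autoImplicit false

noncomputable section

open scoped Classical

open WeierstrassCurve NumberField IsDedekindDomain Field PowerSeries
open Literature.NumberTheory.EllipticCurves Literature.NumberTheory.EllipticCurves.GreenbergSelmer
  Literature.NumberTheory.EllipticCurves.ModularForms Literature.NumberTheory.EllipticCurves.Rank1Residual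
  Literature.NumberTheory.EllipticCurves.Rank1Residual.Typed Literature.NumberTheory.EllipticCurves.Castella2018
  Literature.NumberTheory.EllipticCurves.Module Literature.NumberTheory.GaloisRepresentations
  Literature.NumberTheory.GaloisCohomology Literature.RingTheory.FittingIdeal
open Summit.BirchSwinnertonDyer.Rank1Residual.X11b.AcSelmer Summit.BirchSwinnertonDyer.Rank1Residual.X11b.Halves

namespace Summit.BirchSwinnertonDyer.Rank1Residual.X11b

/-! ### §1 The torsion-only package at a datum -/

section Shapes

variable {K : Type} [Field K] [NumberField K] (W : WeierstrassCurve ℚ) (p : ℕ) [Fact p.Prime]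
  (κ : ZpExtension K p) (𝔭 : HeightOneSpectrum (𝓞 K)) (γ : Field.absoluteGaloisGroup K)
  [Fact (κ.IsTopGenerator γ)] (ι : PadicAlgCl p ≃+* ℂ) {N : ℕ}
  (f : CuspForm (CongruenceSubgroup.Gamma0 N) 2)

/-- **ONE-SIDED CONGRUENCE DATA AT A DATUM, TORSION-ONLY (shape; asserts nothing).** Exactly
`P2.OneSidedCongruenceDataAt W p κ 𝔭 γ ι f` WITHOUT the conjunct "no nonzero finite-length
`Λ`-submodule of `X^Σ_ac(E[p^∞])`" (erratum Lemma 2.2): an `R₀`-frame `(Ω_K ≠ 0, Ω_p ∈ R₀ˣ, L)` with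
`IsBDPLFunction ι 𝔭 κ γ f Ω_K Ω_p L` [Cas18 Thm. 3.1]; a finite `Σ` with `X^Σ` `Λ`-TORSION [CTL];
one-sided `Σ`-removal data `P_Σ ≠ 0`, `Ch(X^∅)·(P_Σ) ⊆ Ch(X^Σ)`, `(L^Σ) = (L·P_Σ)`; members `N_m`
(`ModuleCat Λ`, finite) with `Λ`-isomorphisms `X^Σ/p^m ≅ N_m/p^m` [(b)+Lemma 2.1], printed inclusions
`N_m torsion → Ch(N_m)·R₀⟦T⟧ ⊆ (L_m)` [(2.5)_m, FW21 4.41 at `p ∥ N`, PREPRINT] and (c) [Cas20 2.11].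
A predicate; NEVER a theorem in this cell. [claim: Castella2018Erratum, status: under-review]
[cite: Castella2018Erratum, (a)–(c), Lemma 2.1, (2.5), proof of Thm. 1.1 (pp. 2–4) (shape only; nothing asserted)]
[cite: Castella2018, Def. 2.2, (3.1), Thm. 3.1 (arXiv:1704.06608 pp. 5, 9, 11) (shape only; nothing asserted)] -/
@[conjecture]
def P2.OneSidedCongruenceDataTorsionAt : Prop :=
  ∃ (ΩK : ℂ) (Ωp : (unrIntegers p)ˣ) (L : UnrSeries p) (S : Set (HeightOneSpectrum (𝓞 K)))
    (PS : IwasawaAlgebra p) (LS : UnrSeries p) (Nm : ℕ → ModuleCat.{0} (IwasawaAlgebra p))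
    (Lm : ℕ → UnrSeries p),
    ΩK ≠ 0 ∧ IsBDPLFunction ι 𝔭 κ γ f ΩK ((Ωp : unrIntegers p) : ℂ_[p]) L ∧
    S.Finite ∧ Module.IsTorsion (IwasawaAlgebra p) (XAc (W.baseChange K) p κ 𝔭 S γ) ∧
    PS ≠ 0 ∧ XAc.charIdeal (W.baseChange K) p κ 𝔭 ∅ γ * Ideal.span {PS} ≤
      XAc.charIdeal (W.baseChange K) p κ 𝔭 S γ ∧
    Ideal.span {LS} = Ideal.span {L * PowerSeries.map (toUnr p) PS} ∧
    (∀ m : ℕ, Module.Finite (IwasawaAlgebra p) (Nm m)) ∧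
    (∀ m : ℕ, 1 ≤ m → Nonempty
      ((XAc (W.baseChange K) p κ 𝔭 S γ ⧸
          ((Ideal.span {(PowerSeries.C (p : ℤ_[p]) : IwasawaAlgebra p)}) ^ m •
            (⊤ : Submodule (IwasawaAlgebra p) (XAc (W.baseChange K) p κ 𝔭 S γ)))) ≃ₗ[IwasawaAlgebra p]
        ((Nm m) ⧸ ((Ideal.span {(PowerSeries.C (p : ℤ_[p]) : IwasawaAlgebra p)}) ^ m •
          (⊤ : Submodule (IwasawaAlgebra p) (Nm m)))))) ∧
    (∀ m : ℕ, 1 ≤ m → Module.IsTorsion (IwasawaAlgebra p) (Nm m) →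
      (Module.charIdeal (IwasawaAlgebra p) (Nm m)).map (PowerSeries.map (toUnr p)) ≤ Ideal.span {Lm m}) ∧
    (∀ m : ℕ, 1 ≤ m →
      Ideal.span {Lm m} ⊔ (Ideal.span {(PowerSeries.C ((p : ℕ) : unrIntegers p) : UnrSeries p)}) ^ m =
        Ideal.span {LS} ⊔ (Ideal.span {(PowerSeries.C ((p : ℕ) : unrIntegers p) : UnrSeries p)}) ^ m)

variable {W p κ 𝔭 γ ι f}

/-- **At a datum: torsion-only data ⟹ an `R₀`-frame with `Ch_Λ(X_ac^∅(E[p^∞]))·R₀⟦T⟧ ⊆ (L)`**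
(`AcSelmer.XAc.charIdeal_map_toUnr_le_span_of_oneSided_congruences_of_isTorsion`: the `𝔪^k`-trick
replaces Lemma 2.2). CONDITIONAL on the data. [cite: Castella2018Erratum, proof of Thm. 1.1 (p. 4), read one-sidedly] -/
theorem P2.exists_unrFrame_charIdeal_map_le_of_oneSidedCongruenceDataTorsionAt [W.IsElliptic]
    (h : P2.OneSidedCongruenceDataTorsionAt W p κ 𝔭 γ ι f) :
    ∃ (ΩK : ℂ) (Ωp : (unrIntegers p)ˣ) (L : UnrSeries p), ΩK ≠ 0 ∧
      IsBDPLFunction ι 𝔭 κ γ f ΩK ((Ωp : unrIntegers p) : ℂ_[p]) L ∧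
      (XAc.charIdeal (W.baseChange K) p κ 𝔭 ∅ γ).map (PowerSeries.map (toUnr p)) ≤
        Ideal.span {L} := by
  obtain ⟨ΩK, Ωp, L, S, PS, LS, Nm, Lm, hΩ, hL, hS, hT, hPS, hX, hLS, hfin, he, hF, hc⟩ := h
  haveI : ∀ m, Module.Finite (IwasawaAlgebra p) (Nm m) := hfin
  exact ⟨ΩK, Ωp, L, hΩ, hL,
    AcSelmer.XAc.charIdeal_map_toUnr_le_span_of_oneSided_congruences_of_isTorsion (W.baseChange K) p
      κ 𝔭 γ hS hT (fun m ↦ Nm m) LS Lm (fun m hm ↦ (he m hm).some) hF hc hPS hX hLS⟩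

/-- **At a datum: torsion-only data ⟹ the ♭-frame conjunct of the crux** (+ the glue file's §3).
CONDITIONAL on the data. [cite: Castella2018Erratum, (2.4)–(2.5) and proof of Thm. 1.1 (p. 4)] -/
theorem P2.exists_intCoreFrame_of_oneSidedCongruenceDataTorsionAt [W.IsElliptic]
    (h : P2.OneSidedCongruenceDataTorsionAt W p κ 𝔭 γ ι f) :
    ∃ (ΩK : ℂ) (Ωp : ℂ_[p]) (Q : PowerSeries 𝓞_ℂ_[p]), ΩK ≠ 0 ∧ ‖Ωp‖ = 1 ∧
      R1.IsBDPLFunctionInt p ι 𝔭 κ γ f ΩK Ωp Q ∧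
      (XAc.charIdeal (W.baseChange K) p κ 𝔭 ∅ γ).map (PowerSeries.map (R1.toCpInt p)) ≤
        Ideal.span {Q} := by
  obtain ⟨ΩK, Ωp, L, hΩ, hL, hdiv⟩ :=
    P2.exists_unrFrame_charIdeal_map_le_of_oneSidedCongruenceDataTorsionAt h
  exact P2.exists_intCoreFrame_of_unrFrame_of_charIdeal_map_le W p κ 𝔭 γ ι f hΩ hL hdiv

end Shapes

/-! ### §2 At every erratum datum: the glue to the crux and to both registered stubs -/

section OnTree

variable (W : WeierstrassCurve ℚ) [W.IsElliptic] [W.IsGloballyMinimal] (p : ℕ) [Fact p.Prime]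

/-- **TORSION-ONLY ONE-SIDED CONGRUENCE DATA AT EVERY ERRATUM DATUM of `(W, p)` (shape; asserts
nothing)** — the binders of `P2.IMCDivIntCoreFrameAtErratumData W p` VERBATIM, and at each datum the
package `P2.OneSidedCongruenceDataTorsionAt W p κ 𝔭_{ι'} γ ι' Dt.f`. NO sign condition on `a_p`; NO
Lemma 2.2. A predicate on `(W, p)`; NEVER a theorem in this cell.
[claim: Castella2018Erratum, status: under-review]
[cite: Castella2018Erratum, Thm. 1.1 (i)–(iv) and its proof (pp. 1, 4) (shape only; nothing asserted)] -/
@[conjecture]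
def P2.OneSidedCongruenceDataTorsionAtErratumData : Prop :=
  ∀ [NeZero (W.conductorNorm ℤ)] (q : ℕ) [Fact q.Prime] (K : Type) [Field K] [NumberField K]
    (Dt : ModularParametrizationData W (W.conductorNorm ℤ))
    (H : HeegnerDatum (W.conductorNorm ℤ) (NumberField.discr K)) (w₀ : InfinitePlace K)
    (P : (W.baseChange K).toAffine.Point), ErratumHypotheses W p → W.analyticRank = 1 →
    q ≠ p → Mult W q → ¬ W.HasSplitMultiplicativeReductionAtPrime q →
    ¬ p ∣ padicValInt q W.minimalDiscriminantInt → IsErratumField W K q →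
    Cas20Standing K p (W.conductorNorm ℤ / p) →
    WeierstrassCurve.Affine.Point.map w₀.embedding.toRatAlgHom P = heegnerPointComplex Dt H →
    ¬ (p : ℤ) ∣ Dt.c → ¬ IsOfFinAddOrder P →
    ∀ (κ : ZpExtension K p), κ.IsAnticyclotomic →
      ∀ (γ : Field.absoluteGaloisGroup K) [Fact (κ.IsTopGenerator γ)] (ι' : PadicAlgCl p ≃+* ℂ)
        (e : K →+* ℚ_[p]),
        (∀ k : 𝓞 K, k ∈ (primeOfEmbeddingDatum p ι' w₀.embedding).asIdeal ↔ ‖e (k : K)‖ < 1) →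
        P2.OneSidedCongruenceDataTorsionAt W p κ (primeOfEmbeddingDatum p ι' w₀.embedding) γ ι' Dt.f

variable {W p}

/-- **THE GLUE, TORSION-ONLY (every pair, both signs of `a_p`, no Lemma 2.2): torsion-only one-sided
congruence data at every erratum datum ⟹ `P2.IMCDivIntCoreFrameAtErratumData W p`**, the shape of
crux 19270. CONDITIONAL on the data (PREPRINT-derived at `p ∥ N`); closes nothing by itself.
[cite: Castella2018Erratum, proof of Thm. 1.1 (p. 4), read one-sidedly] [cite: Skinner2016PacificMC, §3.1 (p. 192)] -/
theorem P2.imcDivIntCoreFrameAtErratumData_of_oneSidedCongruenceDataTorsion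
    (h : P2.OneSidedCongruenceDataTorsionAtErratumData W p) :
    P2.IMCDivIntCoreFrameAtErratumData W p := by
  intro _ q _ K _ _ Dt H w₀ P hE hr hqp hmq hns hvq hK hCas hP hc hinf κ hκ γ _ ι' e he
  exact P2.exists_intCoreFrame_of_oneSidedCongruenceDataTorsionAt
    (h q K Dt H w₀ P hE hr hqp hmq hns hvq hK hCas hP hc hinf κ hκ γ ι' e he)

/-- **Registered stub S1 `stub_imcDivErratum_nonsplitAtP` of crux 19270 — signature VERBATIM as
conclusion — from the torsion-only data on every pair** (sign hypothesis unused). CONDITIONAL on the data.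
[cite: Castella2018Erratum, Thm. 1.1 and its proof (pp. 1, 4)] -/
theorem P2.stub_imcDivErratum_nonsplitAtP_of_oneSidedCongruenceDataTorsion
    (h : ∀ (W : WeierstrassCurve ℚ) [W.IsElliptic] [W.IsGloballyMinimal] (p : ℕ) [Fact p.Prime],
      P2.OneSidedCongruenceDataTorsionAtErratumData W p) :
    ∀ (W : WeierstrassCurve ℚ) [W.IsElliptic] [W.IsGloballyMinimal] (p : ℕ) [Fact p.Prime],
      ¬ W.HasSplitMultiplicativeReductionAtPrime p →
        Summit.BirchSwinnertonDyer.Rank1Residual.X11b.P2.IMCDivIntCoreFrameAtErratumData W p :=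
  fun W _ _ p _ _ ↦ P2.imcDivIntCoreFrameAtErratumData_of_oneSidedCongruenceDataTorsion (h W p)

/-- **Registered stub S2 `stub_imcDivErratum_splitAtP` of crux 19270 — signature VERBATIM as conclusion —
from the SAME torsion-only data** (sign hypothesis unused). CONDITIONAL on the data.
[cite: Castella2018Erratum, Thm. 1.1 and its proof (pp. 1, 4)] -/
theorem P2.stub_imcDivErratum_splitAtP_of_oneSidedCongruenceDataTorsion
    (h : ∀ (W : WeierstrassCurve ℚ) [W.IsElliptic] [W.IsGloballyMinimal] (p : ℕ) [Fact p.Prime],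
      P2.OneSidedCongruenceDataTorsionAtErratumData W p) :
    ∀ (W : WeierstrassCurve ℚ) [W.IsElliptic] [W.IsGloballyMinimal] (p : ℕ) [Fact p.Prime],
      W.HasSplitMultiplicativeReductionAtPrime p →
        Summit.BirchSwinnertonDyer.Rank1Residual.X11b.P2.IMCDivIntCoreFrameAtErratumData W p :=
  fun W _ _ p _ _ ↦ P2.imcDivIntCoreFrameAtErratumData_of_oneSidedCongruenceDataTorsion (h W p)

end OnTree

end Summit.BirchSwinnertonDyer.Rank1Residual.X11b

end
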